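import Literature.IUT.HodgeTheaters.ThetaNFHodgeTheatersProofs
import Literature.IUT.HodgeTheaters.ThetaNFHodgeTheatersProofs2
import Literature.IUT.HodgeTheaters.FrobenioidBridgeModelsWitness
import HarnessLib

/-!
# Morphisms of NF-bridges, Θ-bridges and ΘNF-Hodge theaters ([IUTchI] Definition 5.5 (i)–(iii), pp. 152–153)
# are NON-VACUOUS — abc-iut cell, layer L5, NV-L5 rows `BaseThetaDatum.S5Local.NFBridge.Hom`,
# `BaseThetaDatum.S5Local.ThetaBridge.Hom`, `BaseThetaDatum.S5Local.ThetaNFHodgeTheater.Hom`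

Mochizuki, *Inter-universal Teichmüller theory I*, §5 (kurims May-2020 manuscript), Definition 5.5. Proof-only
companion (no definitions) of `ThetaNFHodgeTheaters.lean`: kernel inhabitants of the three morphism structures of
Definition 5.5, consumed BY NAME. Over an arbitrary stub `S : S5Local 𝔡`:

* `ThetaBridge.Hom.nonempty` / `ThetaBridge.Hom.nonempty_unique`: between ANY two Θ-bridges there is exactly one
  morphism (Def. 5.5 (ii): every component other than the underlying `𝒟`-Θ-bridge morphism is a full
  poly-isomorphism, and the latter is unique, Prop. 4.8 (ii) `DThetaBridge.Hom.nonempty` / `.subsingleton`) —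
  UNCONDITIONAL, every stub [generic].
* `NFBridge.nonempty_hom_iff` / `ThetaNFHodgeTheater.nonempty_hom_iff`: the EXACT inhabitation criterion — a
  morphism of NF-bridges (resp. ΘNF-Hodge theaters) exists iff some isomorphism of the associated `𝒟`-NF-bridges
  (resp. `𝒟`-ΘNF-Hodge theaters) has its `Aut_ε`-orbit of base isomorphisms inside the range of `S.baseGIso`
  ("`‡ψ^NF_⋆` lifts `‡φ^NF_⋆`", Def. 5.5 (i)(d)); the lift is then the preimage of the orbit. Hence
  `NFBridge.Hom.nonempty_of_baseGIso_surjective` / `ThetaNFHodgeTheater.Hom.nonempty_of_baseGIso_surjective`: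
  inhabited between ANY two objects as soon as `S.baseGIso` is surjective on the relevant isomorphs of `ℱ^⊚` — the
  EXISTENCE half of [IUTchI] Cor. 5.3 (i) (p. 144, "`Isom(¹ℱ^⊚, ²ℱ^⊚) → Isom(Base(¹ℱ^⊚), Base(²ℱ^⊚))` is bijective")
  in the stub's vocabulary, the same hypothesis shape as `cor56ii_NF_of_baseGIso_bijective`
  (`ThetaNFHodgeTheatersProofs2.lean`, TODO-merge:abc-iut-L5-t4 Cor. 5.3 (i)) [generic-conditional, honest: for a
  stub whose `baseGIso` misses part of an `Aut_ε`-orbit the type IS empty, `NFBridge.Hom.orbit_subset_range`].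
* `NFBridge.Hom.nonempty_toy` / `ThetaNFHodgeTheater.Hom.nonempty_toy` (+ `exists_…_toy`): UNCONDITIONAL kernel
  inhabitants at the KIT-RULE witness `toyS5Local` over `BaseThetaDatum.trivialModel`
  (`FrobenioidBridgeModelsWitness.lean`, whose `baseGIso` is the identity) [label: parameterRecord / toy stub of
  record — evidence that the TYPE is inhabited, not an arithmetic model].

Record-only; [claim: Mochizuki2012, status: disputed]; instantiated ≠ endorsed; nothing here takes a side.
-/

namespace Literature.IUT.HodgeTheaters

open CategoryTheory

universe u

namespace BaseThetaDatum

variable {𝔡 : BaseThetaDatum.{u}}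

namespace S5Local

variable {S : S5Local 𝔡}

/-! ### Θ-bridges: exactly one morphism between any two (Def. 5.5 (ii) + Prop. 4.8 (ii)) -/

/-- **Def. 5.5 (ii) morphisms are non-vacuous over every stub** ([IUTchI] p. 153): between any two Θ-bridges there
is a morphism — its only recorded datum, the morphism of underlying `𝒟`-Θ-bridges, exists by Prop. 4.8 (ii)
(`DThetaBridge.Hom.nonempty`). [claim: Mochizuki2012, status: disputed] -/
theorem ThetaBridge.Hom.nonempty (T T' : ThetaBridge S) : Nonempty (ThetaBridge.Hom T T') := by
  obtain ⟨u⟩ := DThetaBridge.Hom.nonempty T.under T'.under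
  exact ⟨⟨u⟩⟩

/-- Def. 5.5 (ii) / Cor. 5.6 (ii) for Θ-bridges: the morphism between two Θ-bridges is UNIQUE (Prop. 4.8 (ii)
`DThetaBridge.Hom.subsingleton`, transported by `cor56ii_theta_holds`). [claim: Mochizuki2012, status: disputed] -/
theorem ThetaBridge.Hom.subsingleton (T T' : ThetaBridge S) : Subsingleton (ThetaBridge.Hom T T') :=
  ⟨fun _ _ => (cor56ii_theta_holds T T').1 ((DThetaBridge.Hom.subsingleton T.under T'.under).elim _ _)⟩

/-- Def. 5.5 (ii): "exactly one" morphism between any two Θ-bridges (`Unique`, as a `Nonempty` statement so that no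
definition is introduced). [claim: Mochizuki2012, status: disputed] -/
theorem ThetaBridge.Hom.nonempty_unique (T T' : ThetaBridge S) : Nonempty (Unique (ThetaBridge.Hom T T')) := by
  obtain ⟨φ⟩ := ThetaBridge.Hom.nonempty T T'
  haveI := ThetaBridge.Hom.subsingleton T T'
  exact ⟨uniqueOfSubsingleton φ⟩

/-! ### NF-bridges: the exact inhabitation criterion (Def. 5.5 (i)(d) "lifts") -/

/-- Def. 5.5 (i), morphisms: the `Aut_ε`-orbit of base isomorphisms under a morphism of NF-bridges consists of images
of isomorphisms `¹ℱ^⊚ ⥲ ²ℱ^⊚` ("lifts"), so it lies in the range of `S.baseGIso` — the OBSTRUCTION to inhabiting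
`NFBridge.Hom` over a stub whose base functor misses isomorphisms. [claim: Mochizuki2012, status: disputed] -/
theorem NFBridge.Hom.orbit_subset_range {B B' : NFBridge S} (φ : NFBridge.Hom B B') :
    φ.under.orbit ⊆ Set.range (S.baseGIso : (B.globF ≅ B'.globF) → (S.baseG B.globF ≅ S.baseG B'.globF)) := by
  rw [φ.under_orbit]
  rintro b ⟨e, -, rfl⟩
  exact ⟨e, rfl⟩

/-- **Exact criterion** (Def. 5.5 (i)): a morphism of NF-bridges `B → B'` exists iff some isomorphism of the
associated `𝒟`-NF-bridges has its `Aut_ε`-orbit of base isomorphisms `¹𝒟^⊚ ⥲ ²𝒟^⊚` contained in the range of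
`S.baseGIso`; the lift `¹ℱ^⊚ ⥲ ²ℱ^⊚` is then the preimage poly-isomorphism. [claim: Mochizuki2012, status: disputed] -/
theorem NFBridge.nonempty_hom_iff (B B' : NFBridge S) :
    Nonempty (NFBridge.Hom B B') ↔
      ∃ u : DNFBridge.Hom 𝔡 B.under B'.under,
        u.orbit ⊆ Set.range (S.baseGIso : (B.globF ≅ B'.globF) → (S.baseG B.globF ≅ S.baseG B'.globF)) := by
  constructor
  · rintro ⟨φ⟩
    exact ⟨φ.under, φ.orbit_subset_range⟩
  · rintro ⟨u, hu⟩
    refine ⟨⟨{e | S.baseGIso e ∈ u.orbit}, u, ?_⟩⟩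
    ext b
    constructor
    · intro hb
      obtain ⟨e, rfl⟩ := hu hb
      exact ⟨e, hb, rfl⟩
    · rintro ⟨e, he, rfl⟩
      exact he

/-- **Def. 5.5 (i) morphisms are non-vacuous whenever the base functor reaches every base isomorphism** (the
existence half of [IUTchI] Cor. 5.3 (i), p. 144, in stub vocabulary — the hypothesis shape of
`cor56ii_NF_of_baseGIso_bijective`, TODO-merge:abc-iut-L5-t4): between ANY two NF-bridges there is then a morphism,
lifting an isomorphism of the associated `𝒟`-NF-bridges (which exists: Prop. 4.8 (i), `prop48i_holds`).
[claim: Mochizuki2012, status: disputed] -/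
theorem NFBridge.Hom.nonempty_of_baseGIso_surjective (B B' : NFBridge S)
    (hS : Function.Surjective (S.baseGIso : (B.globF ≅ B'.globF) → (S.baseG B.globF ≅ S.baseG B'.globF))) :
    Nonempty (NFBridge.Hom B B') := by
  obtain ⟨⟨u⟩, -, -⟩ := prop48i_holds B.under B'.under
  exact (NFBridge.nonempty_hom_iff B B').2 ⟨u, fun b _ => hS b⟩

/-! ### ΘNF-Hodge theaters: the exact criterion and the conditional inhabitant (Def. 5.5 (iii)) -/

/-- **Exact criterion** (Def. 5.5 (iii)): a morphism of ΘNF-Hodge theaters `H → H'` exists iff some isomorphism of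
the associated `𝒟`-ΘNF-Hodge theaters (Def. 4.6 (iii): a compatible pair) has the `Aut_ε`-orbit of its NF-component
inside the range of `S.baseGIso`; the Θ-component carries no further datum. [claim: Mochizuki2012, status: disputed] -/
theorem ThetaNFHodgeTheater.nonempty_hom_iff (H H' : ThetaNFHodgeTheater S) :
    Nonempty (ThetaNFHodgeTheater.Hom H H') ↔
      ∃ u : DThetaNFHodgeTheater.Hom H.under H'.under,
        u.nf.orbit ⊆ Set.range (S.baseGIso : (H.globF ≅ H'.globF) → (S.baseG H.globF ≅ S.baseG H'.globF)) := by
  constructor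
  · rintro ⟨φ⟩
    exact ⟨φ.under, φ.nf.orbit_subset_range⟩
  · rintro ⟨u, hu⟩
    obtain ⟨n⟩ := (NFBridge.nonempty_hom_iff H.toNFBridge H'.toNFBridge).2 ⟨u.nf, hu⟩
    -- re-pin the NF-component on `u.nf` itself so that `compat` is `u.compat`
    refine ⟨⟨⟨{e | S.baseGIso e ∈ u.nf.orbit}, u.nf, ?_⟩, ⟨u.theta⟩, u.compat⟩⟩
    ext b
    constructor
    · intro hb
      obtain ⟨e, rfl⟩ := hu hb
      exact ⟨e, hb, rfl⟩
    · rintro ⟨e, he, rfl⟩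
      exact he

/-- **Def. 5.5 (iii) morphisms are non-vacuous whenever the base functor reaches every base isomorphism** (existence
half of Cor. 5.3 (i) in stub vocabulary): between ANY two ΘNF-Hodge theaters there is then a morphism — lift the unique
isomorphism of the associated `𝒟`-ΘNF-Hodge theaters (Prop. 4.8 (ii), `prop48iiHT_holds`), whose compatibility of
index bijections is the `compat` field. [claim: Mochizuki2012, status: disputed] -/
theorem ThetaNFHodgeTheater.Hom.nonempty_of_baseGIso_surjective (H H' : ThetaNFHodgeTheater S)
    (hS : Function.Surjective (S.baseGIso : (H.globF ≅ H'.globF) → (S.baseG H.globF ≅ S.baseG H'.globF))) :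
    Nonempty (ThetaNFHodgeTheater.Hom H H') := by
  obtain ⟨⟨u⟩, -⟩ := prop48iiHT_holds H.under H'.under
  exact (ThetaNFHodgeTheater.nonempty_hom_iff H H').2 ⟨u, fun b _ => hS b⟩

/-- Under the same hypothesis the morphism of ΘNF-Hodge theaters over a GIVEN isomorphism of the associated
`𝒟`-ΘNF-Hodge theaters exists (surjectivity of "the natural functorially induced map" of Cor. 5.6 (ii), repaired form
`Cor56ii_HTR`, existence half only). [claim: Mochizuki2012, status: disputed] -/
theorem ThetaNFHodgeTheater.Hom.exists_under_eq_of_baseGIso_surjective (H H' : ThetaNFHodgeTheater S)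
    (hS : Function.Surjective (S.baseGIso : (H.globF ≅ H'.globF) → (S.baseG H.globF ≅ S.baseG H'.globF)))
    (u : DThetaNFHodgeTheater.Hom H.under H'.under) :
    ∃ φ : ThetaNFHodgeTheater.Hom H H', φ.under = u := by
  refine ⟨⟨⟨{e | S.baseGIso e ∈ u.nf.orbit}, u.nf, ?_⟩, ⟨u.theta⟩, u.compat⟩, rfl⟩
  ext b
  constructor
  · intro hb
    obtain ⟨e, rfl⟩ := hS b
    exact ⟨e, hb, rfl⟩
  · rintro ⟨e, he, rfl⟩
    exact he

end S5Local

/-! ### Unconditional kernel inhabitants at the KIT-RULE witness `toyS5Local` (parameter record, not arithmetic) -/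

/-- [parameterRecord] At the witness stub `toyS5Local` over `trivialModel` (`baseGIso` = identity) there is a morphism
between ANY two NF-bridges. [claim: Mochizuki2012, status: disputed] -/
theorem S5Local.NFBridge.Hom.nonempty_toy (B B' : S5Local.NFBridge toyS5Local) :
    Nonempty (S5Local.NFBridge.Hom B B') :=
  S5Local.NFBridge.Hom.nonempty_of_baseGIso_surjective B B' (toyS5Local_baseGIso_bijective _ _).2

/-- [parameterRecord] At the witness stub `toyS5Local` there is a morphism between ANY two ΘNF-Hodge theaters.
[claim: Mochizuki2012, status: disputed] -/
theorem S5Local.ThetaNFHodgeTheater.Hom.nonempty_toy (H H' : S5Local.ThetaNFHodgeTheater toyS5Local) :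
    Nonempty (S5Local.ThetaNFHodgeTheater.Hom H H') :=
  S5Local.ThetaNFHodgeTheater.Hom.nonempty_of_baseGIso_surjective H H' (toyS5Local_baseGIso_bijective _ _).2

/-- [parameterRecord] The TYPE `NFBridge.Hom` is inhabited in the kernel: NF-bridges over `toyS5Local` exist
(`S5Local.nonempty_nFBridge`, Def. 5.5 (i) non-vacuity) and carry morphisms. [claim: Mochizuki2012, status: disputed] -/
theorem S5Local.exists_nFBridge_hom_toy :
    ∃ B B' : S5Local.NFBridge toyS5Local, Nonempty (S5Local.NFBridge.Hom B B') := by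
  obtain ⟨B⟩ := S5Local.nonempty_nFBridge toyS5Local
  exact ⟨B, B, S5Local.NFBridge.Hom.nonempty_toy B B⟩

/-- [parameterRecord] The TYPE `ThetaBridge.Hom` is inhabited in the kernel (Θ-bridges exist over every stub,
`S5Local.nonempty_thetaBridge`; here at `toyS5Local`). [claim: Mochizuki2012, status: disputed] -/
theorem S5Local.exists_thetaBridge_hom_toy :
    ∃ T T' : S5Local.ThetaBridge toyS5Local, Nonempty (S5Local.ThetaBridge.Hom T T') := by
  obtain ⟨T⟩ := S5Local.nonempty_thetaBridge toyS5Local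
  exact ⟨T, T, S5Local.ThetaBridge.Hom.nonempty T T⟩

/-- [parameterRecord] The TYPE `ThetaNFHodgeTheater.Hom` is inhabited in the kernel: ΘNF-Hodge theaters over
`toyS5Local` exist (`S5Local.nonempty_thetaNFHodgeTheater`, Def. 5.5 (iii) non-vacuity) and carry morphisms.
[claim: Mochizuki2012, status: disputed] -/
theorem S5Local.exists_thetaNFHodgeTheater_hom_toy :
    ∃ H H' : S5Local.ThetaNFHodgeTheater toyS5Local, Nonempty (S5Local.ThetaNFHodgeTheater.Hom H H') := by
  obtain ⟨H⟩ := S5Local.nonempty_thetaNFHodgeTheater toyS5Local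
  exact ⟨H, H, S5Local.ThetaNFHodgeTheater.Hom.nonempty_toy H H⟩

/-- Over EVERY stub: Θ-bridges exist and any two are joined by exactly one morphism — the `ThetaBridge.Hom` row is
witnessed generically (no toy needed). [claim: Mochizuki2012, status: disputed] -/
theorem S5Local.exists_thetaBridge_hom (S : S5Local 𝔡) :
    ∃ T T' : S5Local.ThetaBridge S, Nonempty (Unique (S5Local.ThetaBridge.Hom T T')) := by
  obtain ⟨T⟩ := S5Local.nonempty_thetaBridge S
  exact ⟨T, T, S5Local.ThetaBridge.Hom.nonempty_unique T T⟩

end BaseThetaDatum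

end Literature.IUT.HodgeTheaters
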